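import Literature.AnabelianGeometry.AbsoluteAnabelian.AbsTopISemiAbsoluteSchemaNegative
import Literature.AnabelianGeometry.AbsoluteAnabelian.MLFGaloisGroupsHolds
import Literature.AnabelianGeometry.AbsoluteAnabelian.FreeProlRankLinearProofs
import Literature.AnabelianGeometry.AbsoluteAnabelian.AbsTopIThm26UniversalClosuresRefuted
import HarnessLib

/-!
# [AbsTopI] Thm 2.6 (v) AS TYPED (`FundamentalExtension.Thm26v`, FACT-LIST F-0249) fails IN THE
# `Δ`-tfg REGIME too: the rank-constancy input of its conditional form is not droppable

S. Mochizuki, *Topics in Absolute Anabelian Geometry I: Generalities*, J. Math. Sci. Univ. Tokyo 19 (2012)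
[MochizukiAbsTopI2012], Thm 2.6 (v) p. 22 and its proof p. 24 ("it follows from assertion (ii) that
`ζ(Π) = ζ(G) = [k : ℚ_p]`"); [AbsAnab] Lemma 1.1.4 (ii) p. 8 (the rank formula).

PROOF-ONLY sequel (no definition, no instance, no named fact) to `AbsTopISemiAbsoluteSchemaNegative.lean`
(abc-iut-f-091, FACT-LIST row **F-0249** `FundamentalExtension.Thm26v`).  There the universal closure of the
typed Thm 2.6 (v) was refuted by a split model whose `Δ = ∏_q ℤ_q^ℕ` is NOT topologically finitely generated.
The in-tree conditional form `FundamentalExtension.thm26v_of_coinvariantRankConstant` (abc-iut-L4,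
`AbsTopIThm26vProofs.lean`) derives `Thm26v` from TWO inputs: `Δ` tfg ([AbsTopI] Prop 2.2) and
`CoinvariantRankConstant` (`δ¹_l(Π′) − δ¹_l(G′)` independent of `l`, the content of Thm 2.6 (ii) — FACT-LIST
F-0001, whose own closure is refuted by `not_forall_coinvariantRankConstant`).  This file shows the SECOND
input cannot be dropped even in the presence of the first (and of a splitting):

* `exists_mlfBase_geomTFG_not_thm26v` — the split extension `Π := G_{ℚ_2} × ℤ_2 ↠ G_{ℚ_2}` with MLF base
  datum `K = ℚ_2` SPLITS, has `Δ ≅ ℤ_2` topologically finitely generated (`GeomTFG`), violates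
  `CoinvariantRankConstant` (at `Π′ = Π`: `δ¹_2(Π) − δ¹_2(G) ≥ 3 − 2 = 1` but `δ¹_3(Π) − δ¹_3(G) = 1 − 1 = 0`)
  and violates the typed Thm 2.6 (v): `ζ(Π) ≥ δ¹_2(Π) − δ¹_3(Π) ≥ 3 − 1 = 2 ≠ 1 = [ℚ_2 : ℚ_2]`;
* `not_forall_thm26v_of_geomTFG` — hence `¬ ∀ E B, GeomTFG → SplitsOverOpenSubgroup → Thm26v B`.

The Galois-side ranks are the tree's THEOREM `FundamentalExtension.freeProlRank_gal` (`δ¹_l(G_k) = 1` for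
`l ≠ p`, `δ¹_p(G_k) = [k : ℚ_p] + 1`; abc-iut-L4, from local class field theory, `thm26_ii_delta_gal_holds`);
the two elementary rank facts for a `ℤ_p`-factor are proved here: `freeProlRank_prod_padicInt_le_of_ne`
(`δ¹_l(G × ℤ_p) ≤ δ¹_l(G)` for `l ≠ p`: a continuous homomorphism `ℤ_p → ℤ_l^n` is trivial,
`apply_one_padicInt_eq_one_of_ne`) and `succ_le_freeProlRank_prod_padicInt` (`n ≤ δ¹_p(G) ⇒ n + 1 ≤ δ¹_p(G × ℤ_p)`).

HONEST FRAMING: a statement about ABSTRACT split extensions; [AbsTopI] Thm 2.6 (v) concerns extensions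
arising from hyperbolic orbicurves, where (ii) supplies the rank constancy — nothing in print is disputed;
nothing here bears on the disputed [IUTchIII] Cor. 3.12 or takes a side; typed ≠ proved.
-/

noncomputable section

open Topology Filter

universe u

namespace Literature.AnabelianGeometry.AbsoluteAnabelian

/-! ## Ranks of `G × ℤ_p` -/

section PadicFactor

variable {G : Type u} [Group G] [TopologicalSpace G] {p : ℕ} [Fact p.Prime]

/-- Every continuous additive homomorphism `ℤ_p → ℤ_l` with `l ≠ p` is zero: `g(p^m) = p^m · g(1)` tends
to `0` but has constant norm `‖g(1)‖`; so `g(1) = 0` and `g` vanishes on the dense `ℕ ⊆ ℤ_p`.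
(Adapted from abc-iut's `AbsAnabGeomPredicatesSchemaNegative.lean`, where it is private.) [folklore] -/
private theorem padicInt_addMonoidHom_eq_zero_of_ne {l : ℕ} [Fact l.Prime] (hl : l ≠ p)
    (g : ℤ_[p] →+ ℤ_[l]) (hg : Continuous g) : g = 0 := by
  have hnat : ∀ n : ℕ, g n = (n : ℤ_[l]) * g 1 := fun n =>
    calc g n = g (n • (1 : ℤ_[p])) := by rw [nsmul_one]
      _ = n • g 1 := map_nsmul g n 1
      _ = (n : ℤ_[l]) * g 1 := nsmul_eq_mul n (g 1)
  have hp1 : ‖(p : ℤ_[p])‖ < 1 := by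
    rw [PadicInt.norm_p]
    exact inv_lt_one_of_one_lt₀ (by exact_mod_cast (Fact.out : p.Prime).one_lt)
  have ht : Tendsto (fun m : ℕ => (p : ℤ_[p]) ^ m) atTop (𝓝 0) :=
    tendsto_pow_atTop_nhds_zero_of_norm_lt_one hp1
  have ht' : Tendsto (fun m : ℕ => ‖g ((p : ℤ_[p]) ^ m)‖) atTop (𝓝 0) := by
    have h0 : Tendsto (fun m : ℕ => g ((p : ℤ_[p]) ^ m)) atTop (𝓝 (g 0)) := (hg.tendsto 0).comp ht
    rw [map_zero] at h0
    have h0' := h0.norm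
    rwa [norm_zero] at h0'
  have hcop : l.Coprime p := (Nat.coprime_primes Fact.out Fact.out).mpr hl
  have hnorm : ∀ m : ℕ, ‖g ((p : ℤ_[p]) ^ m)‖ = ‖g 1‖ := fun m => by
    rw [← Nat.cast_pow, hnat, norm_mul,
      PadicInt.norm_natCast_eq_one_iff.mpr (hcop.pow_right m), one_mul]
  have h1 : g 1 = 0 := by
    simp_rw [hnorm] at ht'
    exact norm_eq_zero.mp (tendsto_nhds_unique tendsto_const_nhds ht')
  have hzero : ∀ n : ℕ, g n = 0 := fun n => by rw [hnat, h1, mul_zero]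
  have hfun : (g : ℤ_[p] → ℤ_[l]) = fun _ => 0 :=
    Continuous.ext_on (PadicInt.denseRange_natCast) hg continuous_const
      (by rintro _ ⟨n, rfl⟩; exact hzero n)
  ext x
  exact congrFun hfun x

/-- A continuous homomorphism `G × ℤ_p → ℤ_l^n` with `l ≠ p` is trivial on the factor `1 × ℤ_p` (each
coordinate restricted to `ℤ_p` is a continuous additive homomorphism `ℤ_p → ℤ_l`) — the elementary
reason why a `ℤ_p`-factor does not contribute to `δ¹_l`, `l ≠ p`. [cite: MochizukiAbsTopI2012, Thm 2.6 p.21] -/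
theorem apply_one_padicInt_eq_one_of_ne {l : ℕ} [Fact l.Prime] (hl : l ≠ p) {n : ℕ}
    (F : G × Multiplicative ℤ_[p] →ₜ* Multiplicative (Fin n → ℤ_[l])) (z : Multiplicative ℤ_[p]) :
    F (1, z) = 1 := by
  apply Multiplicative.toAdd.injective
  funext i
  -- the `i`-th coordinate of `F` on the `ℤ_p`-factor, additively
  let g : ℤ_[p] →+ ℤ_[l] :=
    { toFun := fun x => Multiplicative.toAdd (F (1, Multiplicative.ofAdd x)) i
      map_zero' := by
        change Multiplicative.toAdd (F (1, 1)) i = 0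
        rw [Prod.mk_one_one, map_one, toAdd_one, Pi.zero_apply]
      map_add' := fun a b => by
        have hab : ((1 : G), Multiplicative.ofAdd (a + b)) =
            ((1 : G), Multiplicative.ofAdd a) * ((1 : G), Multiplicative.ofAdd b) := by
          rw [Prod.mk_mul_mk, mul_one, ofAdd_add]
        change Multiplicative.toAdd (F (1, Multiplicative.ofAdd (a + b))) i = _
        rw [hab, map_mul, toAdd_mul, Pi.add_apply] }
  have hg : Continuous g :=
    (continuous_apply i).comp (continuous_toAdd.comp ((map_continuous F).comp
      (continuous_const.prodMk continuous_ofAdd)))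
  have hg0 := padicInt_addMonoidHom_eq_zero_of_ne hl g hg
  have hz : g (Multiplicative.toAdd z) = 0 := by rw [hg0, AddMonoidHom.zero_apply]
  change Multiplicative.toAdd (F (1, Multiplicative.ofAdd (Multiplicative.toAdd z))) i = 0 at hz
  rw [ofAdd_toAdd] at hz
  rw [hz, toAdd_one, Pi.zero_apply]

/-- **`δ¹_l(G × ℤ_p) ≤ δ¹_l(G)` for `l ≠ p`**: a continuous surjection `G × ℤ_p ↠ ℤ_l^n` kills `1 × ℤ_p`,
so its restriction to `G × 1` is already surjective. [cite: MochizukiAbsTopI2012, Thm 2.6 p.21] -/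
theorem freeProlRank_prod_padicInt_le_of_ne {l : ℕ} [Fact l.Prime] (hl : l ≠ p) :
    freeProlRank (G × Multiplicative ℤ_[p]) l ≤ freeProlRank G l := by
  refine freeProlRank_le_of_forall l fun n F hF => ?_
  refine le_freeProlRank_of_surjective l
    (F.comp (ContinuousMonoidHom.inl G (Multiplicative ℤ_[p]))) fun y => ?_
  obtain ⟨⟨g, z⟩, rfl⟩ := hF y
  refine ⟨g, ?_⟩
  change F ((ContinuousMonoidHom.inl G (Multiplicative ℤ_[p])) g) = F (g, z)
  have hsplit : ((g, z) : G × Multiplicative ℤ_[p]) = (g, 1) * (1, z) := by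
    rw [Prod.mk_mul_mk, mul_one, one_mul]
  rw [show (ContinuousMonoidHom.inl G (Multiplicative ℤ_[p])) g = (g, 1) from rfl, hsplit, map_mul,
    apply_one_padicInt_eq_one_of_ne hl F z, mul_one]

/-- **`n ≤ δ¹_p(G) ⇒ n + 1 ≤ δ¹_p(G × ℤ_p)`**: a continuous surjection `G ↠ ℤ_p^N` (`N ≥ n`) and the
identity of the `ℤ_p`-factor combine to `G × ℤ_p ↠ ℤ_p^{N+1}`. [cite: MochizukiAbsTopI2012, Thm 2.6 p.21] -/
theorem succ_le_freeProlRank_prod_padicInt {n : ℕ} (hn : (n : ℕ∞) ≤ freeProlRank G p) :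
    ((n + 1 : ℕ) : ℕ∞) ≤ freeProlRank (G × Multiplicative ℤ_[p]) p := by
  -- a continuous surjection `G ↠ ℤ_p^N` with `n ≤ N`
  obtain ⟨N, F, hnN, hF⟩ : ∃ (N : ℕ) (F : G →ₜ* Multiplicative (Fin N → ℤ_[p])),
      n ≤ N ∧ Function.Surjective F := by
    rcases Nat.eq_zero_or_pos n with rfl | hn0
    · refine ⟨0, ⟨1, continuous_const⟩, le_rfl, fun y => ⟨1, ?_⟩⟩
      apply Multiplicative.toAdd.injective
      funext i
      exact i.elim0
    · exact exists_surjective_of_le_freeProlRank p hn0 hn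
  -- `(g, z) ↦ (z, F g) ∈ ℤ_p^{N+1}`
  let Φ : G × Multiplicative ℤ_[p] →ₜ* Multiplicative (Fin (N + 1) → ℤ_[p]) :=
    { toFun := fun x => Multiplicative.ofAdd
        (Fin.cons (Multiplicative.toAdd x.2) (Multiplicative.toAdd (F x.1)) : Fin (N + 1) → ℤ_[p])
      map_one' := by
        change Multiplicative.ofAdd _ = Multiplicative.ofAdd 0
        congr 1
        funext i
        refine Fin.cases ?_ (fun j => ?_) i
        · rw [Fin.cons_zero, Prod.snd_one, toAdd_one, Pi.zero_apply]
        · rw [Fin.cons_succ, Prod.fst_one, map_one, toAdd_one, Pi.zero_apply, Pi.zero_apply]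
      map_mul' := fun x y => by
        rw [← ofAdd_add]
        congr 1
        funext i
        refine Fin.cases ?_ (fun j => ?_) i
        · rw [Pi.add_apply, Fin.cons_zero, Fin.cons_zero, Fin.cons_zero, Prod.snd_mul, toAdd_mul]
        · rw [Pi.add_apply, Fin.cons_succ, Fin.cons_succ, Fin.cons_succ, Prod.fst_mul, map_mul,
            toAdd_mul, Pi.add_apply]
      continuous_toFun := continuous_ofAdd.comp
        (Continuous.finCons (A := fun _ : Fin (N + 1) => ℤ_[p])
          (continuous_toAdd.comp continuous_snd)
          (continuous_toAdd.comp ((map_continuous F).comp continuous_fst))) }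
  have hΦ_apply : ∀ x : G × Multiplicative ℤ_[p], Multiplicative.toAdd (Φ x) =
      (Fin.cons (Multiplicative.toAdd x.2) (Multiplicative.toAdd (F x.1)) : Fin (N + 1) → ℤ_[p]) :=
    fun _ => rfl
  have hΦ : Function.Surjective Φ := by
    intro y
    obtain ⟨g, hg⟩ := hF (Multiplicative.ofAdd (Fin.tail (Multiplicative.toAdd y)))
    refine ⟨(g, Multiplicative.ofAdd (Multiplicative.toAdd y 0)), ?_⟩
    apply Multiplicative.toAdd.injective
    rw [hΦ_apply, hg, toAdd_ofAdd, toAdd_ofAdd, Fin.cons_self_tail]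
  calc ((n + 1 : ℕ) : ℕ∞) ≤ ((N + 1 : ℕ) : ℕ∞) := by exact_mod_cast Nat.succ_le_succ hnN
    _ ≤ freeProlRank (G × Multiplicative ℤ_[p]) p := le_freeProlRank_of_surjective p Φ hΦ

end PadicFactor

/-! ## F-0249 in the `Δ`-tfg regime -/

namespace FundamentalExtension

/-- **F-0249, a SPLIT model with `Δ` topologically finitely generated violating the typed Thm 2.6 (v).**
The split extension `Π := G_{ℚ_2} × ℤ_2 ↠ G_{ℚ_2}` (first projection) with MLF base datum `K = ℚ_2`:
(a) splits over `G`; (b) `Δ = 1 × ℤ_2` is topologically finitely generated (`GeomTFG`, by `(1, 1)`);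
(c) VIOLATES `CoinvariantRankConstant` — at `Π′ = Π`: `δ¹_2(Π) − δ¹_2(G) ≥ 3 − 2 = 1` while
`δ¹_3(Π) − δ¹_3(G) = 1 − 1 = 0` (ranks of `G_{ℚ_2}` by `freeProlRank_gal`, i.e. local class field theory);
(d) VIOLATES `Thm26v`: `ζ(Π) ≥ δ¹_2(Π) − δ¹_3(Π) ≥ 2 ≠ 1 = [ℚ_2 : ℚ_2]`.  So in
`thm26v_of_coinvariantRankConstant (hΔ : Δ tfg) (hc : CoinvariantRankConstant)` the input `hc` (the content of
Thm 2.6 (ii)) cannot be dropped. [cite: MochizukiAbsTopI2012, Thm 2.6 (v) p.22] -/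
theorem exists_mlfBase_geomTFG_not_thm26v :
    ∃ (E : FundamentalExtension.{0}) (B : E.MLFBase),
      E.SplitsOverOpenSubgroup ∧ E.GeomTFG ∧ ¬ E.CoinvariantRankConstant ∧ ¬ E.Thm26v B := by
  classical
  let Z : Type := Multiplicative ℤ_[2]
  let Γ : Type := Field.absoluteGaloisGroup ℚ_[2]
  let E : FundamentalExtension.{0} :=
    { arith := ProfiniteGrp.of (Γ × Z)
      gal := absoluteGaloisGrp ℚ_[2]
      aug := ContinuousMonoidHom.fst Γ Z
      aug_surjective := fun g => ⟨(g, 1), rfl⟩ }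
  let B : E.MLFBase := { p := 2, K := ℚ_[2], galIso := ContinuousMulEquiv.refl _ }
  -- the ranks of `G = G_{ℚ_2}`: `δ¹_2 = [ℚ_2 : ℚ_2] + 1 = 2`, `δ¹_3 = 1`
  have hG := freeProlRank_gal B
  have hG2 : freeProlRank Γ 2 = ((2 : ℕ) : ℕ∞) := by
    have h := hG.2
    rw [Module.finrank_self] at h
    exact h
  have hG3 : freeProlRank Γ 3 = ((1 : ℕ) : ℕ∞) := by exact_mod_cast hG.1 3 (by decide)
  -- the ranks of `Π = G_{ℚ_2} × ℤ_2`: `δ¹_2 ≥ 3`, `δ¹_3 ≤ 1`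
  have hP2 : ((3 : ℕ) : ℕ∞) ≤ freeProlRank (Γ × Z) 2 :=
    succ_le_freeProlRank_prod_padicInt (n := 2) (by rw [hG2])
  have hP3 : freeProlRank (Γ × Z) 3 ≤ ((1 : ℕ) : ℕ∞) :=
    (freeProlRank_prod_padicInt_le_of_ne (p := 2) (by decide)).trans hG3.le
  refine ⟨E, B, ?_, ?_, ?_, ?_⟩
  · -- (a) the splitting `G → Π`, `g ↦ (g, 1)`
    refine ⟨⊤, (ContinuousMonoidHom.inl Γ Z).comp ⟨(⊤ : Subgroup Γ).subtype, continuous_subtype_val⟩,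
      ?_, fun u => rfl⟩
    rw [Subgroup.coe_top]
    exact isOpen_univ
  · -- (b) `ℤ_2` is topologically generated by `1`, and `Δ` is its image under `z ↦ (1, z)`
    have hd : DenseRange (fun k : ℤ => Multiplicative.ofAdd ((k : ℤ_[2]))) :=
      (Multiplicative.ofAdd.surjective.denseRange).comp PadicInt.denseRange_intCast continuous_ofAdd
    have hsub : Set.range (fun k : ℤ => Multiplicative.ofAdd ((k : ℤ_[2]))) ⊆
        (Subgroup.zpowers (Multiplicative.ofAdd (1 : ℤ_[2])) : Set Z) := by
      rintro _ ⟨k, rfl⟩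
      refine ⟨k, ?_⟩
      change Multiplicative.ofAdd (1 : ℤ_[2]) ^ k = Multiplicative.ofAdd (k : ℤ_[2])
      rw [← ofAdd_zsmul, zsmul_one]
    have hZ : IsTopologicallyFinitelyGenerated Z := by
      refine ⟨⟨{Multiplicative.ofAdd (1 : ℤ_[2])}, ?_⟩⟩
      apply SetLike.coe_injective
      rw [Subgroup.topologicalClosure_coe, Subgroup.coe_top, Finset.coe_singleton,
        ← Subgroup.zpowers_eq_closure]
      exact (Dense.mono hsub hd).closure_eq
    let j : Z →ₜ* E.geom :=
      ⟨(MonoidHom.inr Γ Z).codRestrict E.geom fun z => E.mem_geom.mpr rfl,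
        (continuous_const.prodMk continuous_id).subtype_mk _⟩
    have hj : Function.Surjective j := by
      rintro ⟨⟨g, z⟩, hgz⟩
      have hg : g = 1 := E.mem_geom.mp hgz
      subst hg
      exact ⟨z, rfl⟩
    exact hZ.of_surjective j hj
  · -- (c) rank constancy fails at `Π′ = Π`, `l₁ = 2`, `l₂ = 3`
    intro hc
    have hopen : IsOpen (((⊤ : Subgroup E.arith)) : Set E.arith) := by
      rw [Subgroup.coe_top]
      exact isOpen_univ
    have h := hc ⊤ hopen 2 3
    have hmap : Subgroup.map E.aug.toMonoidHom (⊤ : Subgroup E.arith) = ⊤ :=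
      Subgroup.map_top_of_surjective _ E.aug_surjective
    rw [hmap] at h
    simp only [freeProlRank_top] at h
    change freeProlRank (Γ × Z) 2 - freeProlRank Γ 2 = freeProlRank (Γ × Z) 3 - freeProlRank Γ 3 at h
    rw [hG2, hG3, tsub_eq_zero_of_le hP3] at h
    have h1 : ((3 : ℕ) : ℕ∞) - ((2 : ℕ) : ℕ∞) ≤ freeProlRank (Γ × Z) 2 - ((2 : ℕ) : ℕ∞) :=
      tsub_le_tsub_right hP2 _
    rw [h, ← ENat.coe_sub] at h1
    exact absurd (by exact_mod_cast h1 : (3 - 2 : ℕ) ≤ 0) (by decide)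
  · -- (d) `ζ(Π) ≥ δ¹_2(Π) − δ¹_3(Π) ≥ 2`, whereas the typed (v) demands `ζ(Π) = [ℚ_2 : ℚ_2] = 1`
    rintro ⟨hζ, -⟩
    change zetaInv (Γ × Z) = ((Module.finrank ℚ_[2] ℚ_[2] : ℕ) : ℕ∞) at hζ
    rw [Module.finrank_self] at hζ
    have h2 : ((3 : ℕ) : ℕ∞) - ((1 : ℕ) : ℕ∞) ≤ zetaInv (Γ × Z) := by
      unfold zetaInv
      exact le_iSup₂_of_le ⟨2, Nat.prime_two⟩ ⟨3, Nat.prime_three⟩ (tsub_le_tsub hP2 hP3)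
    rw [hζ, ← ENat.coe_sub] at h2
    exact absurd (by exact_mod_cast h2 : (3 - 1 : ℕ) ≤ 1) (by decide)

/-- **FACT-LIST F-0249, universal closure REFUTED in the regime "`Δ` tfg + split"**: the typed [AbsTopI]
Thm 2.6 (v) does not follow from MLF base data, a splitting and the topological finite generation of `Δ`
alone — the rank-constancy input (`CoinvariantRankConstant`, Thm 2.6 (ii)) of
`thm26v_of_coinvariantRankConstant` is essential (witness `G_{ℚ_2} × ℤ_2 ↠ G_{ℚ_2}`).
[cite: MochizukiAbsTopI2012, Thm 2.6 (v) p.22] -/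
theorem not_forall_thm26v_of_geomTFG :
    ¬ ∀ (E : FundamentalExtension.{0}) (B : E.MLFBase),
        E.GeomTFG → E.SplitsOverOpenSubgroup → E.Thm26v B := by
  intro H
  obtain ⟨E, B, hs, htfg, -, hv⟩ := exists_mlfBase_geomTFG_not_thm26v
  exact hv (H E B htfg hs)

end FundamentalExtension

end Literature.AnabelianGeometry.AbsoluteAnabelian

end
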